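import Summits.BirchSwinnertonDyer.Rank1Residual.Additive.PotSupersingularTargets
import Summits.BirchSwinnertonDyer.Rank1Residual.Additive.AdditiveOrdinaryLowerHalf
import HarnessLib

/-!
# Rung W-ALL (D-0120): ALT-CLOSERS BY NAME — the ADDITIVE exclusion class (cell `bsd-wall`, lane 2, seat ty-2)

HONEST FRAMING (cell `bsd-wall`, run/shared/lean/pub/bsd-wall/, HUMAN RULING D-0120; WALL-BRIEF-v1 §2;
companion of `WAll/AltClosers.lean`, same rules: NOTHING ASSERTED, no `def`, no `@[conjecture]`, no
named fact, no route file imported). The ADDITIVE exclusion class of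
`Rank1Residual.bsdp_allCurves_of_not_corner_of_not_cornerF` (its domain hypothesis `hdom` fails at a
non-CM pair with `p` odd and `Addv W p`) in ty-1's shape (PROP NAMES v0, `WAll.WAllExclAdditive`):
`∀ (W) [W.IsElliptic] [W.IsGloballyMinimal] (p) [Fact p.Prime], ¬ W.HasCM → p ≠ 2 → Addv W p →
W.analyticRank ≤ 1 → BSDp W p`.

SUB-CELL LATTICE (all typed in the tree, cited not restated): at an odd additive prime the pair is
potentially multiplicative `SubM` (= `PotMult`, `ord_p j < 0`), potentially good ORDINARY of
Delbourgo's type (G) `SubGordOrd`, TAME potentially supersingular `ClassO5` (= `(G) ∧ ss` ∪ `(t′)`),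
or WILD `ClassO6` (`p = 3`) — `Additive.addv_odd_cells` (`Additive/PotSupersingularClasses.lean`).
The first two are the locus `N10.Locus W p := p ≠ 2 ∧ Addv W p ∧ (PotMult W p ∨ TypeGOrd W p)` of the
rung-K1 leaf. Registered leaves (D-0061) and targets by sub-cell:
* `N10.Locus` (rows B2 = N10 `r = 0`, B6 = O7-ord `r = 1`): leaf K1
  `Additive.AdditiveOrdinaryLowerHalf` (route `AdditiveBranchIMC`) = the LOWER half
  `MissingLowerBoundAt`; the UPPER half is a kernel theorem from print on sub-rows only —
  `ClassX4M.missingUpperBoundAt_rankZero_of_surj_noL20`, `ClassX3M.missingUpperBoundAt_rankZero_of_prop414`,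
  `ClassX4Gord.missingUpperBoundAt_rankZero_of_katoComponent_of_surj` (rank `0`; Kato 2004 Thm 17.4 /
  Wuthrich 2014 Thm 16 / Delbourgo 1998 Prop 4 / Greenberg 1999 Prop 4.14 binders) — so the
  class-wide upper half enters below as the explicit hypothesis `hUp` (its residual = non-surjective
  image rows, `p ∣ #E(ℚ)_tors` rows, and every `r = 1` row off `O7RankOneStatements` §3);
  door leaf `Theorems.SchneiderFree.AdditiveX3RankOneLower` (route `SchneiderFreeAdditiveX3`) is the
  `r = 1 ∧ ClassX3 ∧ SubSemistableTwist` slice of the same lower half;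
* `ClassO5`: target `Additive.O5.Statement` ⇐ `O5Sharp` ⇔ leaves K8 `Additive.O5SharpGss` (route
  `QuadraticBranchSignedControl`) ∧ K9-tame `Additive.O5SharpTprime` (route
  `KatoDescentTamePotSupersingular`) — `Additive.o5Sharp_iff`, `Additive.O5.statement_of_o5Sharp`;
* `ClassO6`: target `Additive.O6.Statement` ⇐ leaf K9-wild `Additive.O6Sharp` (route
  `KatoDescentPotSupersingular`) — `Additive.O6.statement_of_o6Sharp`;
* rung W2 `Additive.N11.KimAtThreeRankZeroPUB` (route `KimAtThreeKolyvagin`; X4 at `p = 3`, `r = 0`,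
  `3`-adic tower surjective, no local `3`-torsion) closes its rows PER PAIR through
  `N11.bsdp_three_of_kimAtThreeRankZeroPUB_of_kuriharaUnitAt` (Kurihara-unit and `3 ∤ ∏ c_ℓ` side
  conditions) — a pair-level closer inside `ClassO5 ∪ ClassO6 ∪ SubGordOrd` at `3`, recorded by name only.

References: WALL-BRIEF-v1.md §0/§2 (row 2); LADDER-BSD.md §1c (K1, W2, K8, K9 leaves);
`Additive/PotSupersingularClasses.lean`, `Additive/PotSupersingularTargets.lean`,
`Additive/N10LowerHalfStatements.lean`, `Additive/AdditiveOrdinaryLowerHalf.lean`.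
-/

noncomputable section

open scoped Classical

open WeierstrassCurve Literature.NumberTheory.EllipticCurves
  Literature.NumberTheory.EllipticCurves.Rank1Residual
  Literature.NumberTheory.EllipticCurves.Rank1Residual.Typed

set_option autoImplicit false

namespace Summit.BirchSwinnertonDyer.Rank1Residual.WAll

open Additive

/-! ## §1 The class from its four sub-cells -/

/-- **Additive exclusion class ⇐ its sub-cells** (`addv_odd_cells`: `SubM ∨ SubGordOrd ∨ ClassO5 ∨
ClassO6` at every odd additive prime; `SubM ∪ SubGordOrd ⊆ N10.Locus`). The ordinary-type branch is
taken in its closed-leaf currency `N10.Locus` (K1), the supersingular-type branches as the tree's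
targets `O5.Statement`, `O6.Statement`. [folklore] -/
theorem exclAdditive_of_cells
    (hOrd : ∀ (W : WeierstrassCurve ℚ) [W.IsElliptic] [W.IsGloballyMinimal] (p : ℕ) [Fact p.Prime],
      ¬ W.HasCM → W.analyticRank ≤ 1 → N10.Locus W p → BSDp W p)
    (h5 : O5.Statement) (h6 : O6.Statement) :
    ∀ (W : WeierstrassCurve ℚ) [W.IsElliptic] [W.IsGloballyMinimal] (p : ℕ) [Fact p.Prime],
      ¬ W.HasCM → p ≠ 2 → Addv W p → W.analyticRank ≤ 1 → BSDp W p := by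
  intro W _ _ p _ hcm hp hadd hr
  rcases addv_odd_cells W p hp hadd with hM | hG | hO5 | hO6
  · exact hOrd W p hcm hr ⟨hp, hadd, Or.inl hM⟩
  · exact hOrd W p hcm hr ⟨hp, hadd, Or.inr hG.2⟩
  · exact h5 W p hr hO5
  · exact h6 W p hr hO6

/-! ## §2 The sub-cells from the registered leaves -/

/-- **O5 target ⇐ leaves K8 ∧ K9-tame** (`O5SharpGss`, `O5SharpTprime`; GZK converts the
`MissingPPartAt` currency to `BSDp`): `o5Sharp_iff` + `O5.statement_of_o5Sharp`. [folklore] -/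
theorem o5Statement_of_sharpLeaves (hG : O5SharpGss) (hT : O5SharpTprime)
    (hGZK : rank_eq_analyticRank_of_analyticRank_le_one) : O5.Statement :=
  O5.statement_of_o5Sharp (o5Sharp_iff.mpr ⟨hG, hT⟩) hGZK

/-- **O6 target ⇐ leaf K9-wild** (`O6Sharp`; GZK): `O6.statement_of_o6Sharp`. [folklore] -/
theorem o6Statement_of_sharpLeaf (h : O6Sharp) (hGZK : rank_eq_analyticRank_of_analyticRank_le_one) :
    O6.Statement :=
  O6.statement_of_o6Sharp h hGZK

/-- **The ordinary-type branch ⇐ leaf K1 + the class-wide UPPER half** (`AdditiveOrdinaryLowerHalf`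
gives `MissingLowerBoundAt` on `N10.Locus` in rank `≤ 1`; `hUp` is the Euler-system half
`MissingUpperBoundAt` on the same locus — IN PRINT only on the sub-rows named in the module docstring,
OPEN class-wide; GZK converts the two halves to `BSDp`). [folklore] -/
theorem ordType_of_lowerHalf_of_upperHalf (hK1 : AdditiveOrdinaryLowerHalf)
    (hUp : ∀ (W : WeierstrassCurve ℚ) [W.IsElliptic] [W.IsGloballyMinimal] (p : ℕ) [Fact p.Prime],
      W.analyticRank ≤ 1 → N10.Locus W p → MissingUpperBoundAt W p)
    (hGZK : rank_eq_analyticRank_of_analyticRank_le_one) :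
    ∀ (W : WeierstrassCurve ℚ) [W.IsElliptic] [W.IsGloballyMinimal] (p : ℕ) [Fact p.Prime],
      ¬ W.HasCM → W.analyticRank ≤ 1 → N10.Locus W p → BSDp W p :=
  fun W _ _ p _ _ hr hL ↦
    bsdp_of_missingPPartAt W p hGZK hr
      (missingPPartAt_of_lower_of_upper W p (hK1 W p hr hL) (hUp W p hr hL))

/-! ## §3 The registry theorem: the additive class from K1 + K8 + K9 (+ the open upper half) -/

/-- **Additive exclusion class ⇐ leaves K1, K8, K9-tame, K9-wild + the ordinary-type upper half +
GZK.** The one residual hypothesis that is not a registered leaf is `hUp` (module docstring).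
[folklore] -/
theorem exclAdditive_of_leaves (hK1 : AdditiveOrdinaryLowerHalf)
    (hUp : ∀ (W : WeierstrassCurve ℚ) [W.IsElliptic] [W.IsGloballyMinimal] (p : ℕ) [Fact p.Prime],
      W.analyticRank ≤ 1 → N10.Locus W p → MissingUpperBoundAt W p)
    (hK8 : O5SharpGss) (hK9t : O5SharpTprime) (hK9w : O6Sharp)
    (hGZK : rank_eq_analyticRank_of_analyticRank_le_one) :
    ∀ (W : WeierstrassCurve ℚ) [W.IsElliptic] [W.IsGloballyMinimal] (p : ℕ) [Fact p.Prime],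
      ¬ W.HasCM → p ≠ 2 → Addv W p → W.analyticRank ≤ 1 → BSDp W p :=
  exclAdditive_of_cells (ordType_of_lowerHalf_of_upperHalf hK1 hUp hGZK)
    (o5Statement_of_sharpLeaves hK8 hK9t hGZK) (o6Statement_of_sharpLeaf hK9w hGZK)

/-- **Conversely, the additive exclusion class gives back each target** (so the sub-cell split loses
nothing): `O5.Statement`, `O6.Statement`, and `BSDp` on `N10.Locus`, for non-CM curves. CM curves
at additive primes are NOT in this class (rank `0`: row C8; rank `1`: `CornerF`). [folklore] -/
theorem cells_of_exclAdditive
    (h : ∀ (W : WeierstrassCurve ℚ) [W.IsElliptic] [W.IsGloballyMinimal] (p : ℕ) [Fact p.Prime],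
      ¬ W.HasCM → p ≠ 2 → Addv W p → W.analyticRank ≤ 1 → BSDp W p) :
    (∀ (W : WeierstrassCurve ℚ) [W.IsElliptic] [W.IsGloballyMinimal] (p : ℕ) [Fact p.Prime],
      ¬ W.HasCM → W.analyticRank ≤ 1 → N10.Locus W p → BSDp W p) ∧
    (∀ (W : WeierstrassCurve ℚ) [W.IsElliptic] [W.IsGloballyMinimal] (p : ℕ) [Fact p.Prime],
      ¬ W.HasCM → W.analyticRank ≤ 1 → ClassO5 W p → BSDp W p) ∧
    (∀ (W : WeierstrassCurve ℚ) [W.IsElliptic] [W.IsGloballyMinimal] (p : ℕ) [Fact p.Prime],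
      ¬ W.HasCM → W.analyticRank ≤ 1 → ClassO6 W p → BSDp W p) :=
  ⟨fun W _ _ p _ hcm hr hL ↦ h W p hcm hL.1 hL.2.1 hr,
    fun W _ _ p _ hcm hr hO ↦ h W p hcm hO.1 hO.2.1 hr,
    fun W _ _ p _ hcm hr hO ↦ h W p hcm hO.1 hO.2.1 hr⟩

end Summit.BirchSwinnertonDyer.Rank1Residual.WAll

end
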